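import Summits.CriticalPhenomena.PercolationContinuityZ3.Theorems.Transplant.FKDoubleFanOneSidedDominance
import HarnessLib

/-!
# Double fans `K₂ ∨ P_{m+1}`: CANONICAL RECOVERY of depth-1 `a`-planes — the pinned line is the `bc`-free line (rank one), the other generator is
# the second `N^{(bc)}`-ISOTROPIC line: the `bc`-master form vanishes identically on `Σ` and on `F_a(ker P_a)`

Helper file (`--supports stmt-CriticalPhenomena-4575`), FK sub-lane `prim-bschramm-fk-3` (gen 46); builds on p205010 (kernel theorem, internal audit
signed; external expert review pending).  Pure real algebra, no sorries; standard axioms.  Memo `bschramm/prim-bschramm-fk-3/FAR-CROSS-XXI.md` §0(D), §2.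

Every representation question of the far cross-apex programme (`HypSet` of `…SetLevel`, `HypSetBA` of `…FanExchange`, the fibres of FAR-CROSS-XX §3d) asks
whether a given plane is a depth-1 `a`-plane `F_a·span(u, P_a u)` (`P_a u = AC_1 ∗ u`) for SOME admissible `F, u`.  This file records the exact identities
that make the two generators of such a plane CANONICAL, so that `(F, u)` is recovered in closed form instead of solved for:
* the split `u = P_a u + N_a u` (**`sepA u`** `= u − AC_1∗u`, fibre masses `(u₀, u_ab, −u₀, u_bc, −u_ab−u_bc)`) is pushed through the gadget:
  `F_a u = σ + H`, `σ := F_a(P_a u)`, `H := F_a(N_a u)`, and the `a`-image is **`imgA q F u = H ∧ σ`** (**`imgA_eq_wedgeH_sep`**);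
* `σ` is `bc`-FREE and RANK ONE: `σ_bc = 0`, `σ_ab σ_ac = σ₀ σ₁` (**`zbc_fanCombo_pinned`**, **`rankOne_fanCombo_pinned`**), while `(F_a X)_bc = F_ac X_bc` in general
  (**`zbc_fanCombo`**) — so for `F_ac u_bc ≠ 0` the `σ`-line is `plane ∩ {Z_bc = 0}`;
* the `bc`-MASTER FORM `N^{(bc)} = masterN ∘ swapAB` of `…ThreeApexAlgebra` VANISHES on both generators: **`nBC_fanCombo_pinned`** (`N^{(bc)}(σ) = 0`, i.e.
  `Σ ⊂ {N^{(bc)} = 0}`) and **`nBC_fanCombo_sepA`** (`N^{(bc)}(F_a n) = 0` for every `n ∈ ker P_a`), hence on the plane `N^{(bc)}(aσ + bH) = ab·N^{(bc)}(F_a u)`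
  (**`nBC_fanCombo_pencil`**, with **`pencilA u a b`** `= a·P_a u + b·N_a u`): the restriction of `N^{(bc)}` to a depth-1 `a`-plane is the rank-two form whose
  isotropic lines are exactly `σ` and `H` — **the second generator `H` is the `N^{(bc)}`-conjugate of the pinned line**, for every `F` and `u`
  (no positivity needed).  Feasibility of `H ∈ F_a(ker P_a)` is then a closed-form check (memo §0(D)(iii)); no cubic appears.
[folklore]
-/

noncomputable section

namespace Summit.CriticalPhenomena.PercolationContinuityZ3.Theorems

namespace FK

namespace ThreeApex

/-- The `a`-separated part `N_a u = u − AC_1 ∗ u` of a state (fibre masses `(u₀, u_ab, −u₀, u_bc, −u_ab−u_bc)`; it spans `ker P_a` as `u` varies). [folklore] -/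
def sepA (u : V5) : V5 := ⟨u.z0, u.zab, -u.z0, u.zbc, -(u.zab + u.zbc)⟩

/-- `sepA u = u − AC_1 ∗ u` coordinatewise. [folklore] -/
theorem sepA_eq (u : V5) :
    sepA u = ⟨u.z0 - (conv (edgeAC 1) u).z0, u.zab - (conv (edgeAC 1) u).zab, u.zac - (conv (edgeAC 1) u).zac, u.zbc - (conv (edgeAC 1) u).zbc,
      u.z1 - (conv (edgeAC 1) u).z1⟩ := by
  ext <;> simp only [sepA, conv, edgeAC, V5.total] <;> ring

/-- `P_a` kills the separated part: `AC_1 ∗ sepA u = 0`. [folklore] -/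
theorem conv_edgeAC_one_sepA (u : V5) : conv (edgeAC 1) (sepA u) = ⟨0, 0, 0, 0, 0⟩ := by
  ext <;> simp only [sepA, conv, edgeAC, V5.total] <;> ring

/-- The pencil `a·P_a u + b·N_a u` of the input plane (`(1,1) ↦ u`, `(1,0) ↦ P_a u`, `(0,1) ↦ N_a u`). [folklore] -/
def pencilA (u : V5) (a b : ℝ) : V5 :=
  ⟨b * u.z0, b * u.zab, a * (u.z0 + u.zac) - b * u.z0, b * u.zbc, a * (u.zab + u.zbc + u.z1) - b * (u.zab + u.zbc)⟩

/-- `pencilA u 1 1 = u`. [folklore] -/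
theorem pencilA_one_one (u : V5) : pencilA u 1 1 = u := by
  ext <;> simp [pencilA]

/-- `pencilA u 1 0 = AC_1 ∗ u`. [folklore] -/
theorem pencilA_one_zero (u : V5) : pencilA u 1 0 = conv (edgeAC 1) u := by
  ext <;> simp only [pencilA, conv, edgeAC, V5.total] <;> ring

/-- `pencilA u 0 1 = sepA u`. [folklore] -/
theorem pencilA_zero_one (u : V5) : pencilA u 0 1 = sepA u := by
  ext <;> simp [pencilA, sepA]

/-! ### The split of the `a`-image -/

/-- **`F_a u = σ + H`** coordinatewise, `σ = F_a(AC_1∗u)`, `H = F_a(sepA u)` (linearity of the gadget in the state). [folklore] -/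
theorem fanCombo_split (q : ℝ) (F u : V5) :
    fanCombo q F u = ⟨(fanCombo q F (conv (edgeAC 1) u)).z0 + (fanCombo q F (sepA u)).z0,
      (fanCombo q F (conv (edgeAC 1) u)).zab + (fanCombo q F (sepA u)).zab, (fanCombo q F (conv (edgeAC 1) u)).zac + (fanCombo q F (sepA u)).zac,
      (fanCombo q F (conv (edgeAC 1) u)).zbc + (fanCombo q F (sepA u)).zbc, (fanCombo q F (conv (edgeAC 1) u)).z1 + (fanCombo q F (sepA u)).z1⟩ := by
  ext <;> simp only [fanCombo, sepA, conv, edgeAC, detach, V5.total] <;> ring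

/-- **The `a`-image is the wedge of the separated image and the pinned image**: `imgA q F u = F_a(N_a u) ∧ F_a(P_a u)`. [folklore] -/
theorem imgA_eq_wedgeH_sep (q : ℝ) (F u : V5) :
    imgA q F u = wedgeH (fanCombo q F (sepA u)) (fanCombo q F (conv (edgeAC 1) u)) := by
  ext <;> simp only [imgA, wedgeH, fanCombo, sepA, conv, edgeAC, detach, hx, hy, hz, V5.total] <;> ring

/-! ### The pinned line: `bc`-free and rank one -/

/-- `(F_a X)_bc = F_ac · X_bc`: only the identity term of the gadget keeps mass on `bc|a`. [folklore] -/
theorem zbc_fanCombo (q : ℝ) (F X : V5) : (fanCombo q F X).zbc = F.zac * X.zbc := by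
  simp only [fanCombo, conv, edgeAC, detach, V5.total]; ring

/-- The pinned image is `bc`-free: `(F_a(AC_1∗u))_bc = 0`. [folklore] -/
theorem zbc_fanCombo_pinned (q : ℝ) (F u : V5) : (fanCombo q F (conv (edgeAC 1) u)).zbc = 0 := by
  rw [zbc_fanCombo]; simp only [conv, edgeAC, V5.total]; ring

/-- `(F_a(sepA u))_bc = F_ac · u_bc` (so the `σ`-line is `plane ∩ {Z_bc = 0}` whenever `F_ac u_bc ≠ 0`). [folklore] -/
theorem zbc_fanCombo_sepA (q : ℝ) (F u : V5) : (fanCombo q F (sepA u)).zbc = F.zac * u.zbc := by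
  rw [zbc_fanCombo]; rfl

/-- **The pinned image is rank one**: `σ_ab·σ_ac = σ₀·σ₁` for `σ = F_a(AC_1∗u)` (`σ = λπ + μDπ`, `(σ₀,σ_ab,σ_ac,σ₁) = (μ,λ) ⊗ (ŷ, v̂−ŷ)`). [folklore] -/
theorem rankOne_fanCombo_pinned (q : ℝ) (F u : V5) :
    (fanCombo q F (conv (edgeAC 1) u)).zab * (fanCombo q F (conv (edgeAC 1) u)).zac =
      (fanCombo q F (conv (edgeAC 1) u)).z0 * (fanCombo q F (conv (edgeAC 1) u)).z1 := by
  simp only [fanCombo, conv, edgeAC, detach, V5.total]; ring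

/-! ### The `bc`-master form vanishes on both generators -/

/-- **`N^{(bc)}(σ) = 0`**: the `bc`-master form vanishes on every pinned image (`Σ ⊂ {N^{(bc)} = 0}`). [folklore] -/
theorem nBC_fanCombo_pinned (q : ℝ) (F u : V5) : masterN q (swapAB (fanCombo q F (conv (edgeAC 1) u))) = 0 := by
  simp only [masterN, swapAB, fanCombo, conv, edgeAC, detach, V5.total]; ring

/-- **`N^{(bc)}(F_a n) = 0` for every `n ∈ ker P_a`**: the gadget maps the separated part into the quadric cone `{N^{(bc)} = 0}`. [folklore] -/
theorem nBC_fanCombo_sepA (q : ℝ) (F u : V5) : masterN q (swapAB (fanCombo q F (sepA u))) = 0 := by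
  simp only [masterN, swapAB, fanCombo, sepA, conv, edgeAC, detach, V5.total]; ring

/-- **`N^{(bc)}` on a depth-1 `a`-plane is the rank-two form with isotropic lines `σ` and `H`**:
`N^{(bc)}(F_a(a·P_a u + b·N_a u)) = a·b·N^{(bc)}(F_a u)`. [folklore] -/
theorem nBC_fanCombo_pencil (q : ℝ) (F u : V5) (a b : ℝ) :
    masterN q (swapAB (fanCombo q F (pencilA u a b))) = a * b * masterN q (swapAB (fanCombo q F u)) := by
  simp only [masterN, swapAB, fanCombo, pencilA, conv, edgeAC, detach, V5.total]; ring

/-- In particular the `H`-line is determined by the plane and `σ`: if `X = a·P_a u + b·N_a u` lies on the plane with `b ≠ 0` and `N^{(bc)}(F_a X) = 0` while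
`N^{(bc)}(F_a u) ≠ 0`, then `a = 0` (`X` is on the `H`-line). [folklore] -/
theorem pencil_isotropic_iff (q : ℝ) (F u : V5) (hN : masterN q (swapAB (fanCombo q F u)) ≠ 0) {a b : ℝ} (hb : b ≠ 0)
    (h0 : masterN q (swapAB (fanCombo q F (pencilA u a b))) = 0) : a = 0 := by
  rw [nBC_fanCombo_pencil] at h0
  rcases mul_eq_zero.1 h0 with h | h
  · rcases mul_eq_zero.1 h with h' | h'
    · exact h'
    · exact absurd h' hb
  · exact absurd h hN

end ThreeApex

end FK

end Summit.CriticalPhenomena.PercolationContinuityZ3.Theorems
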